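import Summits.BirchSwinnertonDyer.BirchSwinnertonDyer.Theses.PrintX10b
import Summits.BirchSwinnertonDyer.BirchSwinnertonDyer.Theorems.PrintX10bHowardContainmentLightFrameX10bOfKolyvaginSystemLeaf
import Summits.BirchSwinnertonDyer.BirchSwinnertonDyer.Theorems.PrintX10bAssemblyLightTwinsX10b
import Summits.BirchSwinnertonDyer.BirchSwinnertonDyer.Theorems.PrintX10bTwoSidedLinkAnyClassNumberX10bPinnedOfPrint
import Summits.BirchSwinnertonDyer.BirchSwinnertonDyer.Theorems.PrintX10bAnalyticMuZeroX10b
import HarnessLib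

/-!
# Row-10 DISPLAY: the corner `WAllCornerX10b` and the partition leaf `X10.BSDpOnClassX10b` from SEVEN cite-only print binders
# of `PrintX10b.closes` — `hCG`, `hNV`, `hTw` gone from the booked ten-leaf display

Cell `pub/bsd-print-x9`, seat `bsd-line-x10b-p2` (LEAD g11). THEOREMS ONLY; `--supports` (helper); no `closes` change is made
here (the pen decides). Companion of `PrintX10bHowardContainmentLightFrameX10bOfKolyvaginSystemLeaf` (the A-side light pinned
containment 27274 from `hH hK hMZ hCGS`, X10b twin of the x9-p1 LEAD's KS-leaf re-plumbing): here that containment is fed, with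
the route's closed doors BY NAME — the light assembly `PrintX10bAssemblyLightTwinsX10b.assemblyLightTwinsX10b_proof` (27276,
p622251), the B₃ door `PrintX10bPinned.twoSidedLinkAnyClassNumberX10bPinnedOfPrint_holds` (p613989) and analytic `μ = 0`
`Cruxes.AnalyticMuZeroX10b.TheoremB.AnalyticMuZeroX10b_of` (20682) — into `WAll.wallCornerX10b_of_bsdpOnClassX10b`, exactly as
the booked display `PrintX10bCornerOfPrintLeaves.wallCornerX10b_of_printLeaves` (p681093/p681136; hyps hH hK hCG hMZ hNV hCGS hTw
hPT hHP hP) does with the ten. Hypotheses HERE: `HowardDVRKolyvaginBound` (23087, Howard 2004 Thm. 1.6.1),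
`CGLSHeegnerKolyvaginSystem` (23236, CGLS 2022 Thm. 4.1.1 KS form), `MastellaZermanHowardDivisibility` (25233, MZ26 Cor. 4.6),
`CGSHowardDivisibilityPLocalized` (27112, CGS 2025 Thm. 6.5.2), `PinnedTransferPrintFacts` (26358), `HeegnerPrintFactsX10b`
(21206), `PrintFactsX10b` (20684) — SEVEN; `CoatesGreenbergKummerImage` (23427) left with the closure of 23237 (CG-FRAME),
`CGLSHeegnerClassNonvanishing` (27103) with the KS-leaf torsion (x9-p1 LEAD g7 core + the companion file),
`AnticyclotomicTowerSharp` (27076) is a theorem. This module imports by-name closers of the route (theses-cone lint: warning,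
as for every display file).

HONEST FRAMING. CONDITIONAL on seven statement-only print leaves (REF-131/132/136/137-policed); a DISPLAY for the pen /
director, not route currency by itself; BSD is NOT proved by this file or by anything it imports; no summit statement is
proved; «beyond-print theorem»: no.

References: [Howard2004HeegnerKolyvagin] Thm. 1.6.1; [CastellaGrossiLeeSkinner2022] Thm. 4.1.1; [CastellaGrossiSkinner2025]
Thm. 6.5.2; [MastellaZerman2026] Cor. 4.6; [JetchevSkinnerWan2017] Thm. 3.3.1; [YanZhu2026] Thm. 4.9, 5.7 (1), 5.9.
-/

set_option linter.dupNamespace false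
set_option autoImplicit false

noncomputable section

open Summit.BirchSwinnertonDyer.BirchSwinnertonDyer.Theses.PrintX10b
  (HowardDVRKolyvaginBound CGLSHeegnerKolyvaginSystem MastellaZermanHowardDivisibility CGSHowardDivisibilityPLocalized
    PinnedTransferPrintFacts HeegnerPrintFactsX10b PrintFactsX10b)
open Summit.BirchSwinnertonDyer.BirchSwinnertonDyer.Theorems

namespace Summit.BirchSwinnertonDyer.BirchSwinnertonDyer.Theorems.PrintX10bCornerOfKSLeaf

/-- **Row-10 corner `WAllCornerX10b` ⟸ SEVEN cite-only print binders** — `HowardDVRKolyvaginBound` (23087),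
`CGLSHeegnerKolyvaginSystem` (23236), `MastellaZermanHowardDivisibility` (25233), `CGSHowardDivisibilityPLocalized` (27112),
`PinnedTransferPrintFacts` (26358), `HeegnerPrintFactsX10b` (21206), `PrintFactsX10b` (20684) — through the closed doors BY NAME
(the light assembly `assemblyLightTwinsX10b_proof`, the B₃ door `twoSidedLinkAnyClassNumberX10bPinnedOfPrint_holds`, analytic
`μ = 0` `AnalyticMuZeroX10b_of`) and the companion file's §2 containment. = the booked ten-leaf display minus `hCG` (23427; discharged on the
frames by CG-FRAME), `hNV` (27103; replaced by F-411 at the engine's class) and `hTw` (27076; a theorem).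
[cite: Howard2004HeegnerKolyvagin, Thm. 1.6.1] [cite: CastellaGrossiLeeSkinner2022, Thm. 4.1.1] [cite: CastellaGrossiSkinner2025, Thm. 6.5.2]
[cite: MastellaZerman2026, Cor. 4.6] [cite: JetchevSkinnerWan2017, Thm. 3.3.1] -/
theorem wallCornerX10b_of_kolyvaginSystemLeaf_of_printBinders
    (hH : HowardDVRKolyvaginBound) (hK : CGLSHeegnerKolyvaginSystem) (hMZ : MastellaZermanHowardDivisibility)
    (hCGS : CGSHowardDivisibilityPLocalized) (hPT : PinnedTransferPrintFacts) (hHP : HeegnerPrintFactsX10b)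
    (hP : PrintFactsX10b) : Summit.BirchSwinnertonDyer.WAllCornerX10b :=
  Summit.BirchSwinnertonDyer.Rank1Residual.WAll.wallCornerX10b_of_bsdpOnClassX10b
    (PrintX10bAssemblyLightTwinsX10b.assemblyLightTwinsX10b_proof
      (PrintX10bOfKSLeaf.howardContainmentLightFrameX10bPinned_of_howard_kolyvaginSystem_mz_cgs hH hK hMZ hCGS)
      (PrintX10bPinned.twoSidedLinkAnyClassNumberX10bPinnedOfPrint_holds hPT hHP)
      hHP Summit.BirchSwinnertonDyer.BirchSwinnertonDyer.Cruxes.AnalyticMuZeroX10b.TheoremB.AnalyticMuZeroX10b_of hP)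

/-- **Partition leaf `X10.BSDpOnClassX10b` ⟸ the same SEVEN cite-only binders** (through the light assembly, p622251).
[cite: Howard2004HeegnerKolyvagin, Thm. 1.6.1] [cite: CastellaGrossiLeeSkinner2022, Thm. 4.1.1] [cite: CastellaGrossiSkinner2025, Thm. 6.5.2]
[cite: MastellaZerman2026, Cor. 4.6] -/
theorem bsdpOnClassX10b_of_kolyvaginSystemLeaf_of_printBinders
    (hH : HowardDVRKolyvaginBound) (hK : CGLSHeegnerKolyvaginSystem) (hMZ : MastellaZermanHowardDivisibility)
    (hCGS : CGSHowardDivisibilityPLocalized) (hPT : PinnedTransferPrintFacts) (hHP : HeegnerPrintFactsX10b)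
    (hP : PrintFactsX10b) : Summit.BirchSwinnertonDyer.Rank1Residual.X10.BSDpOnClassX10b :=
  PrintX10bAssemblyLightTwinsX10b.assemblyLightTwinsX10b_proof
    (PrintX10bOfKSLeaf.howardContainmentLightFrameX10bPinned_of_howard_kolyvaginSystem_mz_cgs hH hK hMZ hCGS)
    (PrintX10bPinned.twoSidedLinkAnyClassNumberX10bPinnedOfPrint_holds hPT hHP)
    hHP Summit.BirchSwinnertonDyer.BirchSwinnertonDyer.Cruxes.AnalyticMuZeroX10b.TheoremB.AnalyticMuZeroX10b_of hP

end Summit.BirchSwinnertonDyer.BirchSwinnertonDyer.Theorems.PrintX10bCornerOfKSLeaf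

end
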